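import Mathlib
import Summits.Ventures.PercRepro2.CoinFourAtomPush
import Summits.Ventures.PercRepro2.CoinChainAWorldLemmas

/-!
# The pure AND-switch chain under the four-atom ODDS conditions
(blind cell PercRepro2, night-2 g19; proofs/NIGHT2-DARC.md §59.15)

The four-atom sandwich of §57 rests on two «odds conditions» (`fourAtom_sandwich_of_odds`):
with the laws pushed forward to the four marker atoms `00, 10, 01, 11`,
`g₁₀ · (r₀₀ + r₀₁) ≤ g₀₀ · (r₁₀ + r₁₁)` and `g₀₁ · (r₀₀ + r₁₀) ≤ g₀₀ · (r₀₁ + r₁₁)` — the gate's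
odds of «the first marker alone» against «neither» are at most the `R`-law's odds of the first
marker, and symmetrically — plus the log-supermodularity of the gate on the atoms (automatic,
`atom_lsm`).  The covering-marker theorem is the case `g₀₀ = r₀₀`.  Stated at the level of the
core (`fourAtom_functional_nonneg_of_odds`) and specialised to the pure chain
(`pureChain_functional_nonneg_of_odds`): a FIFTH sufficient condition of the row, numeric, the
strongest single one on the exact census of enumerated heads (739 / 750 checks;
mining/night-2/g19/odds.py).
-/

namespace Summit.Ventures.PercRepro2.Coin

section ChainOdds

variable {V : Type*} [DecidableEq V] {R : Type*} [Field R] [LinearOrder R] [IsStrictOrderedRing R]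

/-- **THE FOUR-ATOM ODDS THEOREM ON A CORE.**  The gate `G'` log-supermodular on `U.powerset`
(the `R`-law `G` needs nothing), and the two odds conditions between the gate's marker-atom
sums and the `R`-law's marker sums ⟹ the cleared functional is `≥ 0`. -/
theorem fourAtom_functional_nonneg_of_odds (U : Finset V) (G G' : Finset V → R) (m₁ m₂ : V)
    (hG : ∀ W, 0 ≤ G W) (hG' : ∀ W, 0 ≤ G' W)
    (wMM : ∀ s ⊆ U, ∀ t ⊆ U, G' s * G' t ≤ G' (s ∩ t) * G' (s ∪ t))
    (hodd₁ : (∑ W ∈ U.powerset, G' W * ((if m₁ ∈ W then (1 : R) else 0) *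
        (1 - if m₂ ∈ W then (1 : R) else 0))) *
        (∑ W ∈ U.powerset, G W * (1 - if m₁ ∈ W then (1 : R) else 0)) ≤
      (∑ W ∈ U.powerset, G' W * ((1 - if m₁ ∈ W then (1 : R) else 0) *
        (1 - if m₂ ∈ W then (1 : R) else 0))) *
        (∑ W ∈ U.powerset, G W * (if m₁ ∈ W then (1 : R) else 0)))
    (hodd₂ : (∑ W ∈ U.powerset, G' W * ((1 - if m₁ ∈ W then (1 : R) else 0) *
        (if m₂ ∈ W then (1 : R) else 0))) *
        (∑ W ∈ U.powerset, G W * (1 - if m₂ ∈ W then (1 : R) else 0)) ≤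
      (∑ W ∈ U.powerset, G' W * ((1 - if m₁ ∈ W then (1 : R) else 0) *
        (1 - if m₂ ∈ W then (1 : R) else 0))) *
        (∑ W ∈ U.powerset, G W * (if m₂ ∈ W then (1 : R) else 0))) :
    0 ≤ (∑ W ∈ U.powerset, G W) ^ 2 *
          (∑ W ∈ U.powerset, G' W * ((if m₁ ∈ W then (1 : R) else 0) * (if m₂ ∈ W then (1 : R) else 0)))
        - (∑ W ∈ U.powerset, G W) * (∑ W ∈ U.powerset, G W * (if m₁ ∈ W then (1 : R) else 0)) *
          (∑ W ∈ U.powerset, G' W * (if m₂ ∈ W then (1 : R) else 0))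
        - (∑ W ∈ U.powerset, G W) * (∑ W ∈ U.powerset, G W * (if m₂ ∈ W then (1 : R) else 0)) *
          (∑ W ∈ U.powerset, G' W * (if m₁ ∈ W then (1 : R) else 0))
        + (∑ W ∈ U.powerset, G W * (if m₁ ∈ W then (1 : R) else 0)) *
          (∑ W ∈ U.powerset, G W * (if m₂ ∈ W then (1 : R) else 0)) *
          (∑ W ∈ U.powerset, G' W) := by
  have hx0 := fun W => ite_mem_nonneg (R := R) m₁ W
  have hx1 := fun W => ite_mem_le_one (R := R) m₁ W
  have hy0 := fun W => ite_mem_nonneg (R := R) m₂ W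
  have hy1 := fun W => ite_mem_le_one (R := R) m₂ W
  obtain ⟨r₀, hr₀⟩ : ∃ r₀ : R, r₀ = ∑ W ∈ U.powerset, G W *
    ((1 - if m₁ ∈ W then (1 : R) else 0) * (1 - if m₂ ∈ W then (1 : R) else 0)) := ⟨_, rfl⟩
  obtain ⟨r₁, hr₁⟩ : ∃ r₁ : R, r₁ = ∑ W ∈ U.powerset, G W *
    ((if m₁ ∈ W then (1 : R) else 0) * (1 - if m₂ ∈ W then (1 : R) else 0)) := ⟨_, rfl⟩
  obtain ⟨r₂, hr₂⟩ : ∃ r₂ : R, r₂ = ∑ W ∈ U.powerset, G W *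
    ((1 - if m₁ ∈ W then (1 : R) else 0) * (if m₂ ∈ W then (1 : R) else 0)) := ⟨_, rfl⟩
  obtain ⟨r₁₂, hr₁₂⟩ : ∃ r₁₂ : R, r₁₂ = ∑ W ∈ U.powerset, G W *
    ((if m₁ ∈ W then (1 : R) else 0) * (if m₂ ∈ W then (1 : R) else 0)) := ⟨_, rfl⟩
  obtain ⟨g₀, hg₀⟩ : ∃ g₀ : R, g₀ = ∑ W ∈ U.powerset, G' W *
    ((1 - if m₁ ∈ W then (1 : R) else 0) * (1 - if m₂ ∈ W then (1 : R) else 0)) := ⟨_, rfl⟩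
  obtain ⟨g₁, hg₁⟩ : ∃ g₁ : R, g₁ = ∑ W ∈ U.powerset, G' W *
    ((if m₁ ∈ W then (1 : R) else 0) * (1 - if m₂ ∈ W then (1 : R) else 0)) := ⟨_, rfl⟩
  obtain ⟨g₂, hg₂⟩ : ∃ g₂ : R, g₂ = ∑ W ∈ U.powerset, G' W *
    ((1 - if m₁ ∈ W then (1 : R) else 0) * (if m₂ ∈ W then (1 : R) else 0)) := ⟨_, rfl⟩
  obtain ⟨g₁₂, hg₁₂⟩ : ∃ g₁₂ : R, g₁₂ = ∑ W ∈ U.powerset, G' W *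
    ((if m₁ ∈ W then (1 : R) else 0) * (if m₂ ∈ W then (1 : R) else 0)) := ⟨_, rfl⟩
  have hr₀0 : 0 ≤ r₀ := hr₀ ▸ Finset.sum_nonneg fun W _ =>
    mul_nonneg (hG W) (mul_nonneg (by linarith [hx1 W]) (by linarith [hy1 W]))
  have hr₁0 : 0 ≤ r₁ := hr₁ ▸ Finset.sum_nonneg fun W _ =>
    mul_nonneg (hG W) (mul_nonneg (hx0 W) (by linarith [hy1 W]))
  have hr₂0 : 0 ≤ r₂ := hr₂ ▸ Finset.sum_nonneg fun W _ =>
    mul_nonneg (hG W) (mul_nonneg (by linarith [hx1 W]) (hy0 W))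
  have hg₀0 : 0 ≤ g₀ := hg₀ ▸ Finset.sum_nonneg fun W _ =>
    mul_nonneg (hG' W) (mul_nonneg (by linarith [hx1 W]) (by linarith [hy1 W]))
  have hg₁0 : 0 ≤ g₁ := hg₁ ▸ Finset.sum_nonneg fun W _ =>
    mul_nonneg (hG' W) (mul_nonneg (hx0 W) (by linarith [hy1 W]))
  have hg₂0 : 0 ≤ g₂ := hg₂ ▸ Finset.sum_nonneg fun W _ =>
    mul_nonneg (hG' W) (mul_nonneg (by linarith [hx1 W]) (hy0 W))
  have hg₁₂0 : 0 ≤ g₁₂ := hg₁₂ ▸ Finset.sum_nonneg fun W _ =>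
    mul_nonneg (hG' W) (mul_nonneg (hx0 W) (hy0 W))
  have hg : g₁ * g₂ ≤ g₀ * g₁₂ := by
    rw [hg₁, hg₂, hg₀, hg₁₂]; exact atom_lsm U G' m₁ m₂ hG' wMM
  -- the seven sums and the odds sums in atom form
  have eΛ : (∑ W ∈ U.powerset, G W) = r₀ + r₁ + r₂ + r₁₂ := by
    rw [hr₀, hr₁, hr₂, hr₁₂]; simp only [← Finset.sum_add_distrib]
    exact Finset.sum_congr rfl fun W _ => by ring
  have eΛ₁ : (∑ W ∈ U.powerset, G W * (if m₁ ∈ W then (1 : R) else 0)) = r₁ + r₁₂ := by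
    rw [hr₁, hr₁₂]; simp only [← Finset.sum_add_distrib]
    exact Finset.sum_congr rfl fun W _ => by ring
  have eΛ₂ : (∑ W ∈ U.powerset, G W * (if m₂ ∈ W then (1 : R) else 0)) = r₂ + r₁₂ := by
    rw [hr₂, hr₁₂]; simp only [← Finset.sum_add_distrib]
    exact Finset.sum_congr rfl fun W _ => by ring
  have eΛ₁' : (∑ W ∈ U.powerset, G W * (1 - if m₁ ∈ W then (1 : R) else 0)) = r₀ + r₂ := by
    rw [hr₀, hr₂]; simp only [← Finset.sum_add_distrib]
    exact Finset.sum_congr rfl fun W _ => by ring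
  have eΛ₂' : (∑ W ∈ U.powerset, G W * (1 - if m₂ ∈ W then (1 : R) else 0)) = r₀ + r₁ := by
    rw [hr₀, hr₁]; simp only [← Finset.sum_add_distrib]
    exact Finset.sum_congr rfl fun W _ => by ring
  have eM : (∑ W ∈ U.powerset, G' W) = g₀ + g₁ + g₂ + g₁₂ := by
    rw [hg₀, hg₁, hg₂, hg₁₂]; simp only [← Finset.sum_add_distrib]
    exact Finset.sum_congr rfl fun W _ => by ring
  have eM₁ : (∑ W ∈ U.powerset, G' W * (if m₁ ∈ W then (1 : R) else 0)) = g₁ + g₁₂ := by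
    rw [hg₁, hg₁₂]; simp only [← Finset.sum_add_distrib]
    exact Finset.sum_congr rfl fun W _ => by ring
  have eM₂ : (∑ W ∈ U.powerset, G' W * (if m₂ ∈ W then (1 : R) else 0)) = g₂ + g₁₂ := by
    rw [hg₂, hg₁₂]; simp only [← Finset.sum_add_distrib]
    exact Finset.sum_congr rfl fun W _ => by ring
  rw [← hg₁, ← hg₀, eΛ₁', eΛ₁] at hodd₁
  rw [← hg₂, ← hg₀, eΛ₂', eΛ₂] at hodd₂
  have key := fourAtom_sandwich_of_odds r₀ r₁ r₂ r₁₂ g₀ g₁ g₂ g₁₂ hr₀0 hr₁0 hr₂0 hg₀0 hg₁0 hg₂0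
    hg₁₂0 hg hodd₁ hodd₂
  rw [eΛ, eΛ₁, eΛ₂, eM, eM₁, eM₂, ← hg₁₂]
  unfold fourAtomT at key
  linarith [key]

/-- **THE PURE CHAIN UNDER THE ODDS CONDITIONS.**  With the hypotheses of `mixture_lsm` for
`(c, d')` (the gate log-supermodular), and the two odds conditions between the gate's marker
atoms and the `R`-law's marker sums, the cleared functional is `≥ 0` at every `ρ`. -/
theorem pureChain_functional_nonneg_of_odds (U ent' : Finset V) (ν c d d' : Finset V → R)
    (ρ : R) (hρ0 : 0 ≤ ρ) (hρ1 : ρ ≤ 1) (hν0 : ∀ W, 0 ≤ ν W)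
    (hν : ∀ s ⊆ U, ∀ t ⊆ U, ν s * ν t ≤ ν (s ∩ t) * ν (s ∪ t))
    (hc0 : ∀ W, 0 ≤ c W) (hd0 : ∀ W, 0 ≤ d W) (hd'0 : ∀ W, 0 ≤ d' W) (hd'c : ∀ W, d' W ≤ c W)
    (hcc : ∀ s t, c s * c t ≤ c (s ∩ t) * c (s ∪ t))
    (hd'd' : ∀ s t, d' s * d' t ≤ d' (s ∩ t) * d' (s ∪ t))
    (hcd' : ∀ s t, c s * d' t ≤ c (s ∩ t) * d' (s ∪ t))
    (hratio' : ∀ s t, s ⊆ t → d' s * c t ≤ c s * d' t) (m₁ m₂ : V)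
    (hodd₁ : (∑ W ∈ U.powerset, ν W * chainMix ∅ ent' ρ c d' W * ((if m₁ ∈ W then (1 : R) else 0) *
        (1 - if m₂ ∈ W then (1 : R) else 0))) *
        (∑ W ∈ U.powerset, ν W * chainMix ∅ ent' ρ c d W * (1 - if m₁ ∈ W then (1 : R) else 0)) ≤
      (∑ W ∈ U.powerset, ν W * chainMix ∅ ent' ρ c d' W * ((1 - if m₁ ∈ W then (1 : R) else 0) *
        (1 - if m₂ ∈ W then (1 : R) else 0))) *
        (∑ W ∈ U.powerset, ν W * chainMix ∅ ent' ρ c d W * (if m₁ ∈ W then (1 : R) else 0)))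
    (hodd₂ : (∑ W ∈ U.powerset, ν W * chainMix ∅ ent' ρ c d' W * ((1 - if m₁ ∈ W then (1 : R) else 0) *
        (if m₂ ∈ W then (1 : R) else 0))) *
        (∑ W ∈ U.powerset, ν W * chainMix ∅ ent' ρ c d W * (1 - if m₂ ∈ W then (1 : R) else 0)) ≤
      (∑ W ∈ U.powerset, ν W * chainMix ∅ ent' ρ c d' W * ((1 - if m₁ ∈ W then (1 : R) else 0) *
        (1 - if m₂ ∈ W then (1 : R) else 0))) *
        (∑ W ∈ U.powerset, ν W * chainMix ∅ ent' ρ c d W * (if m₂ ∈ W then (1 : R) else 0))) :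
    0 ≤ (∑ W ∈ U.powerset, ν W * chainMix ∅ ent' ρ c d W) ^ 2 *
          (∑ W ∈ U.powerset, ν W * chainMix ∅ ent' ρ c d' W *
            ((if m₁ ∈ W then (1 : R) else 0) * (if m₂ ∈ W then (1 : R) else 0)))
        - (∑ W ∈ U.powerset, ν W * chainMix ∅ ent' ρ c d W) *
          (∑ W ∈ U.powerset, ν W * chainMix ∅ ent' ρ c d W * (if m₁ ∈ W then (1 : R) else 0)) *
          (∑ W ∈ U.powerset, ν W * chainMix ∅ ent' ρ c d' W * (if m₂ ∈ W then (1 : R) else 0))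
        - (∑ W ∈ U.powerset, ν W * chainMix ∅ ent' ρ c d W) *
          (∑ W ∈ U.powerset, ν W * chainMix ∅ ent' ρ c d W * (if m₂ ∈ W then (1 : R) else 0)) *
          (∑ W ∈ U.powerset, ν W * chainMix ∅ ent' ρ c d' W * (if m₁ ∈ W then (1 : R) else 0))
        + (∑ W ∈ U.powerset, ν W * chainMix ∅ ent' ρ c d W * (if m₁ ∈ W then (1 : R) else 0)) *
          (∑ W ∈ U.powerset, ν W * chainMix ∅ ent' ρ c d W * (if m₂ ∈ W then (1 : R) else 0)) *
          (∑ W ∈ U.powerset, ν W * chainMix ∅ ent' ρ c d' W) := by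
  have hm0 : ∀ W, 0 ≤ chainMix ∅ ent' ρ c d W := chainMix_nonneg ∅ ent' hρ0 hρ1 hc0 hd0
  have hm'0 : ∀ W, 0 ≤ chainMix ∅ ent' ρ c d' W := chainMix_nonneg ∅ ent' hρ0 hρ1 hc0 hd'0
  have hmix' := mixture_lsm ∅ ent' ρ hρ0 hρ1 c d' hc0 hd'0 hd'c hcc hd'd' hcd' hratio'
  refine fourAtom_functional_nonneg_of_odds U (fun W => ν W * chainMix ∅ ent' ρ c d W)
    (fun W => ν W * chainMix ∅ ent' ρ c d' W) m₁ m₂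
    (fun W => mul_nonneg (hν0 W) (hm0 W)) (fun W => mul_nonneg (hν0 W) (hm'0 W)) ?_ hodd₁ hodd₂
  intro s hs t ht
  calc ν s * chainMix ∅ ent' ρ c d' s * (ν t * chainMix ∅ ent' ρ c d' t)
      = (ν s * ν t) * (chainMix ∅ ent' ρ c d' s * chainMix ∅ ent' ρ c d' t) := by ring
    _ ≤ (ν (s ∩ t) * ν (s ∪ t)) *
          (chainMix ∅ ent' ρ c d' (s ∩ t) * chainMix ∅ ent' ρ c d' (s ∪ t)) :=
        mul_le_mul (hν s hs t ht) (hmix' s t) (mul_nonneg (hm'0 _) (hm'0 _))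
          (mul_nonneg (hν0 _) (hν0 _))
    _ = _ := by ring

end ChainOdds

end Summit.Ventures.PercRepro2.Coin
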